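import Literature.NumberTheory.Automorphic.AdelicGroupDataGLnProofs
import Literature.NumberTheory.Automorphic.AdelicGroupDataCompactMeasure
import HarnessLib

/-!
# `A_G · Γ'` is closed for every subgroup `Γ' ≤ G(K)`: the subgroups `A_G · B(K)`, `A_G · A(K)`
# of the cusp unfoldings (Gelbart, *Automorphic forms on adele groups* (1975), §9.5–9.6: the
# integrals over `Z_∞⁺ B_ℚ \ G_𝔸` and `Z_∞⁺ A_ℚ \ G_𝔸` of (9.44), Lemma 9.11, Prop. 9.17)

Topic `NumberTheory/Automorphic`; theorems only. The unfolding of the parabolic terms of the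
trace formula for `GL₂` replaces the automorphic quotient `G(𝔸) ⧸ A_G G(K)` by the larger
homogeneous spaces `G(𝔸) ⧸ A_G B(K)` and `G(𝔸) ⧸ A_G A(K)`; to apply Weil's formula / integration
in stages there (`Literature.MeasureTheory.Group.InvariantQuotientChainRule`) these subgroups must
be CLOSED. The tree's criterion for `A_G · G(K)`
(`AdelicGroupData.isClosed_quotientSubgroup_of_centralRetraction`: preimage of the discrete `G(K)`
under `g ↦ θ(g)⁻¹ g`) works verbatim for any subgroup `Γ'` of `G(K)`:

* `AdelicGroupData.center'_normal` — `A_G` is normal (it is central);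
* `AdelicGroupData.coe_center'_sup_eq_preimage` — for a central retraction `θ` (values in `A_G`,
  identity on `A_G`, trivial on `G(K)`) and `Γ' ≤ G(K)`:
  `A_G ⊔ Γ' = {g : θ(g)⁻¹ g ∈ Γ'}` (and `= A_G · Γ'` as a set, `coe_center'_sup_eq_mul`);
* `AdelicGroupData.isClosed_center'_sup` — hence `A_G ⊔ Γ'` is closed when `G(K)` is discrete
  and `G(𝔸)` Hausdorff;
* `GLn.isClosed_center'_sup` — **for `GL_n`: `A_G · Γ'` is closed for every `Γ' ≤ GL_n(K)`**
  (`exists_centralRetraction_gl`, `gl_isDiscreteRational_holds`), and `GLn.center'_sup_le` —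
  `A_G ⊔ Γ' ≤ A_G · GL_n(K)`.

## References

* S. Gelbart, *Automorphic forms on adele groups*, Ann. of Math. Studies 83 (1975), §9.5–9.6
  [Gelbart1975].
* A. Borel, *Some finiteness properties of adele groups over number fields*, Publ. Math. IHÉS 16
  (1963), §5 [Borel1963].
-/

noncomputable section

open NumberField IsDedekindDomain Topology
open scoped Pointwise

namespace Literature.NumberTheory.Automorphic

namespace AdelicGroupData

universe u

variable {K : Type} [Field K] [NumberField K]

/-- `A_G` is a normal subgroup of `G(𝔸_K)` (it is central). [folklore] -/
theorem center'_normal (𝒢 : AdelicGroupData.{u} K) : 𝒢.center'.Normal :=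
  ⟨fun a ha x => by
    rw [Subgroup.mem_center_iff.1 (𝒢.center'_le ha) x, mul_inv_cancel_right]; exact ha⟩

/-- `A_G ⊔ Γ' = A_G · Γ'` as a set, for every subgroup `Γ'`. [folklore] -/
theorem coe_center'_sup_eq_mul (𝒢 : AdelicGroupData.{u} K) (Γ' : Subgroup 𝒢.Adelic) :
    ((𝒢.center' ⊔ Γ' : Subgroup 𝒢.Adelic) : Set 𝒢.Adelic) =
      (𝒢.center' : Set 𝒢.Adelic) * (Γ' : Set 𝒢.Adelic) := by
  haveI := 𝒢.center'_normal
  exact Subgroup.normal_mul 𝒢.center' Γ'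

/-- **`A_G ⊔ Γ'` is the preimage of `Γ'` under `g ↦ θ(g)⁻¹ g`** for a central retraction `θ` and
a subgroup `Γ' ≤ G(K)` (if `g = a γ` then `θ(g) = a`; conversely `g = θ(g) · θ(g)⁻¹ g`).
[folklore] -/
theorem coe_center'_sup_eq_preimage (𝒢 : AdelicGroupData.{u} K) (θ : 𝒢.Adelic →* 𝒢.Adelic)
    (hθA : ∀ g, θ g ∈ 𝒢.center') (hθa : ∀ a ∈ 𝒢.center', θ a = a)
    (hθγ : ∀ γ ∈ 𝒢.arithmeticSubgroup, θ γ = 1) {Γ' : Subgroup 𝒢.Adelic}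
    (hΓ' : Γ' ≤ 𝒢.arithmeticSubgroup) :
    ((𝒢.center' ⊔ Γ' : Subgroup 𝒢.Adelic) : Set 𝒢.Adelic) =
      (fun g => (θ g)⁻¹ * g) ⁻¹' (Γ' : Set 𝒢.Adelic) := by
  ext g
  rw [coe_center'_sup_eq_mul, Set.mem_preimage, SetLike.mem_coe]
  constructor
  · rintro ⟨a, ha, γ, hγ, rfl⟩
    have : θ (a * γ) = a := by
      rw [map_mul, hθa a ha, hθγ γ (hΓ' hγ), mul_one]
    change (θ (a * γ))⁻¹ * (a * γ) ∈ Γ'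
    rwa [this, inv_mul_cancel_left]
  · intro hg
    refine ⟨θ g, hθA g, (θ g)⁻¹ * g, hg, ?_⟩
    change θ g * ((θ g)⁻¹ * g) = g
    rw [mul_inv_cancel_left]

/-- **`A_G ⊔ Γ'` is closed** when `G(K)` is discrete, `G(𝔸_K)` is Hausdorff and a continuous
central retraction exists: the preimage of the closed (discrete) `Γ' ≤ G(K)` under the continuous
`g ↦ θ(g)⁻¹ g`. [folklore] -/
theorem isClosed_center'_sup (𝒢 : AdelicGroupData.{u} K) [T2Space 𝒢.Adelic]
    (hdisc : 𝒢.IsDiscreteRational) (θ : 𝒢.Adelic →* 𝒢.Adelic) (hθc : Continuous θ)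
    (hθA : ∀ g, θ g ∈ 𝒢.center') (hθa : ∀ a ∈ 𝒢.center', θ a = a)
    (hθγ : ∀ γ ∈ 𝒢.arithmeticSubgroup, θ γ = 1) {Γ' : Subgroup 𝒢.Adelic}
    (hΓ' : Γ' ≤ 𝒢.arithmeticSubgroup) :
    IsClosed ((𝒢.center' ⊔ Γ' : Subgroup 𝒢.Adelic) : Set 𝒢.Adelic) := by
  haveI : DiscreteTopology 𝒢.arithmeticSubgroup := hdisc
  -- `Γ'` is discrete (a subgroup of the discrete `G(K)`), hence closed
  haveI : DiscreteTopology Γ' := by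
    have hemb : Topology.IsEmbedding (Subgroup.inclusion hΓ') :=
      Topology.IsEmbedding.of_comp (continuous_inclusion hΓ') continuous_subtype_val
        (Topology.IsEmbedding.subtypeVal)
    exact hemb.discreteTopology
  have hΓc : IsClosed (Γ' : Set 𝒢.Adelic) := Subgroup.isClosed_of_discrete
  rw [coe_center'_sup_eq_preimage 𝒢 θ hθA hθa hθγ hΓ']
  exact hΓc.preimage (hθc.inv.mul continuous_id)

end AdelicGroupData

/-! ### `GL_n` -/

section GLn

variable (n : ℕ) (K : Type) [Field K] [NumberField K]

/-- **`A_G · Γ'` is closed in `GL_n(𝔸_K)` for every subgroup `Γ' ≤ GL_n(K)`** (in particular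
`A_G · B(K)` and `A_G · A(K)`, the subgroups of the cusp unfoldings of Gelbart §9.5–9.6).
[cite: Gelbart1975, §9.5] -/
theorem GLn.isClosed_center'_sup {Γ' : Subgroup (AdelicGroupData.gl n K).Adelic}
    (hΓ' : Γ' ≤ (AdelicGroupData.gl n K).arithmeticSubgroup) :
    IsClosed (((AdelicGroupData.gl n K).center' ⊔ Γ' : Subgroup (AdelicGroupData.gl n K).Adelic) :
      Set (AdelicGroupData.gl n K).Adelic) := by
  haveI : T2Space (AdelicGroupData.gl n K).Adelic := t2Space_gl n K
  obtain ⟨θ, hθc, hθA, hθa, hθγ⟩ := exists_centralRetraction_gl n K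
  exact AdelicGroupData.isClosed_center'_sup _ (gl_isDiscreteRational_holds n K) θ hθc hθA hθa hθγ hΓ'

/-- `A_G ⊔ Γ' ≤ A_G · GL_n(K)` for `Γ' ≤ GL_n(K)`. [folklore] -/
theorem GLn.center'_sup_le {Γ' : Subgroup (AdelicGroupData.gl n K).Adelic}
    (hΓ' : Γ' ≤ (AdelicGroupData.gl n K).arithmeticSubgroup) :
    (AdelicGroupData.gl n K).center' ⊔ Γ' ≤ (AdelicGroupData.gl n K).quotientSubgroup :=
  sup_le (AdelicGroupData.gl n K).center'_le_quotientSubgroup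
    (hΓ'.trans (AdelicGroupData.gl n K).arithmeticSubgroup_le_quotientSubgroup)

end GLn

end Literature.NumberTheory.Automorphic
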